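import Literature.Computability.Cryptography.HallgrenParams
import Literature.Computability.Cryptography.HallgrenPostCorrect
import Literature.Computability.Cryptography.ShorOrdPost
import Literature.NumberTheory.QuadraticFields.RealQuadraticRegulator
import HarnessLib

/-!
# The walk parameters of Hallgren's post-processor, read off the input in polynomial time

Topic `Computability/Cryptography`; instantiates `HallgrenPost.WalkParams` (`HallgrenPostProcessor.lean`)
with the explicit parameter functions of `HallgrenParams.lean` composed with the discriminant
`D = fundDiscr d ∈ {d, 4d}` of the input `d = decodeNat x` (Jozsa 2003, §3), and supplies the
`CodeFP` programs the post-processor needs (`HallgrenPost.exists_postFn`): the instance `(D, 1ᵖ)`,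
the grid `N = 2^{2|x|+28}`, and `s₀, T, M` in unary, `Lmin(n) = 6n + 100`. Theorem-and-definition file, no named facts.

* `canonBitsC`, `codeFP_decodeNat` (the numeral decoder of Mathlib as a `CodeFP` program);
* `Dof d = (fundDiscr d).toNat`, `Dof_eq`, `codeFP_Dof`; unary programs `unPredC`, `KQn_un`,
  `s0Of_un`, `TOf_un`, `MOf_un`, `XOf_un`, `precOf_un`;
* **`hallgrenW : WalkParams (ℕ × ℕ)`** and its programs `hallgrenW_dOf_fp`, `hallgrenW_N_fp`, `hallgrenW_s₀_fp`,
  `hallgrenW_T_fp`, `hallgrenW_M_fp`, `hallgrenW_Lmin_fp`.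

## References

* R. Jozsa, arXiv:quant-ph/0302134 (2003), §3, §9. [Jozsa2003]
* S. Arora, B. Barak, *Computational Complexity*, CUP 2009, §1.3. [AroraBarak2009]
-/

noncomputable section

open scoped Classical

namespace Literature.Computability.Cryptography

namespace HallgrenGiantStep

open _root_.Computability Literature.Computability.Complexity Literature.Computability.Complexity.CodeFP
  Literature.Computability.Complexity.LogFP Literature.NumberTheory.QuadraticFields PeriodFinding HallgrenPost InfraPrimitives

/-! ### Decoding the input -/

/-- The last symbol, as a string of length `≤ 1`. [folklore] -/
theorem drop_length_sub_one_eq (l : List Bool) : l.drop (l.length - 1) = l.getLast?.toList := by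
  induction l using List.reverseRecOn with
  | nil => rfl
  | append_singleton l a _ => simp

/-- **`canonBits` on codes**: append `true` after a final `false`. [folklore] -/
theorem canonBitsC : CodeFP strE strE canonBits := by
  have hlen : CodeFP strE unE (fun l => min (l.length - 1) l.length) :=
    (unOfNatMin.comp (strLength.pair (natSub.comp (strNatLength.pair (const _ (1 : ℕ))))) :)
  have hlast : CodeFP strE strE (fun l => l.drop (l.length - 1)) :=
    ((strDrop.comp (hlen.pair (CodeFP.id strE))).congr fun l => by
      show l.drop (min (l.length - 1) l.length) = l.drop (l.length - 1)
      rw [min_eq_left (Nat.sub_le _ _)])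
  have hc : CodeFP strE bitE (fun l => decide (l.drop (l.length - 1) = [false])) :=
    ((CodeFP.eq (eα := strE) (fun _ _ h => h)).comp (hlast.pair (const _ ([false] : List Bool) : CodeFP strE strE fun _ => [false])) :)
  have happ : CodeFP strE strE (fun l => l ++ [true]) :=
    (strAppend.comp ((CodeFP.id strE).pair (const _ ([true] : List Bool) : CodeFP strE strE fun _ => [true])) :)
  refine ((hc.ite happ (CodeFP.id strE)).congr fun l => ?_)
  unfold canonBits
  rw [drop_length_sub_one_eq]
  cases hl : l.getLast? with
  | none => simp
  | some b => cases b <;> simp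

/-- **The numeral decoder is a `CodeFP` program** (`decodeNat = bitsToNat ∘ canonBits`). [folklore] -/
theorem codeFP_decodeNat : CodeFP strE natE decodeNat := (strVal.comp canonBitsC).congr fun l => bitsToNat_canonBits l

/-! ### The discriminant of the input -/

/-- `D = fundDiscr d ∈ {d, 4d}` as a natural number. [cite: Jozsa2003, §3] -/
def Dof (d : ℕ) : ℕ := (Quadratic.fundDiscr d).toNat

/-- `Dof d = d` or `4d` according to `d mod 4`. [cite: Jozsa2003, §3] -/
theorem Dof_eq (d : ℕ) : Dof d = if d % 4 = 1 then d else 4 * d := by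
  unfold Dof Quadratic.fundDiscr
  split_ifs
  · exact Int.toNat_natCast d
  · exact_mod_cast Int.toNat_natCast (4 * d)

/-- The discriminant is computable. [folklore] -/
theorem codeFP_Dof : CodeFP natE natE Dof := by
  have hc : CodeFP natE bitE (fun d => decide (d % 4 = 1)) :=
    (natEq.comp ((natMod.comp ((CodeFP.id natE).pair (const _ (4 : ℕ)))).pair (const _ (1 : ℕ))) :)
  refine ((hc.ite (CodeFP.id natE) (natMul.comp ((const _ (4 : ℕ)).pair (CodeFP.id natE)) :)).congr fun d => ?_)
  rw [Dof_eq]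
  by_cases h : d % 4 = 1 <;> simp [h]

/-! ### The parameters in unary -/

/-- Unary predecessor. [folklore] -/
theorem unPredC : CodeFP unE unE (fun n => n - 1) :=
  (unOfNatMin.comp ((CodeFP.id unE).pair (natSub.comp (natOfUn.pair (const _ (1 : ℕ)))))).congr fun n => by
    show min (n - 1) n = n - 1; exact min_eq_left (Nat.sub_le _ _)

/-- `K(D)` in unary from `D`. [folklore] -/
theorem KQn_un : CodeFP natE unE KQn := by
  have hs : CodeFP natE unE (fun D => D.size - 1) := unPredC.comp codeFP_unSize
  exact (umul' (umul' (const natE (2 : ℕ)) (uadd' hs (const natE (7 : ℕ)))) (uadd' hs (const natE (2 : ℕ)))).congr fun _ => rfl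

/-- `s₀` in unary from `D`. [folklore] -/
theorem s0Of_un : CodeFP natE unE s0Of :=
  (umul' (const natE (2 : ℕ)) (umul' (const natE (4 : ℕ)) (uadd' (umul' (const natE (2 : ℕ)) KQn_un) (const natE (3 : ℕ))))).congr
    fun _ => rfl

/-- `TOf` in unary from `D`. [folklore] -/
theorem TOf_un : CodeFP natE unE TOf :=
  (uadd' (umul' (const natE (3 : ℕ)) codeFP_unSize) (const natE (4 : ℕ))).congr fun _ => rfl

/-- `M` in unary from `(D, 1ᵀ)`. [folklore] -/
theorem MOf_un : CodeFP (pairE natE unE) unE (fun p => MOf p.1 p.2) := by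
  have hD : CodeFP (pairE natE unE) natE (fun p => p.1) := fst _ _
  have hT : CodeFP (pairE natE unE) unE (fun p => p.2) := snd _ _
  exact (uadd' (umul' (const _ (4 : ℕ)) (uadd' (uadd' (umul' (uadd' (umul' (const _ (2 : ℕ)) hT) (const _ (3 : ℕ)))
    (uadd' (KQn_un.comp hD) (const _ (2 : ℕ)))) (codeFP_unSize.comp hD)) (const _ (3 : ℕ)))) (const _ (4 : ℕ))).congr fun _ => rfl

/-- `X` in unary from `(D, 1ᵀ)`. [folklore] -/
theorem XOf_un : CodeFP (pairE natE unE) unE (fun p => XOf p.1 p.2) := by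
  have hD : CodeFP (pairE natE unE) natE (fun p => p.1) := fst _ _
  have hT : CodeFP (pairE natE unE) unE (fun p => p.2) := snd _ _
  exact (uadd' (uadd' (uadd' (umul' hT (uadd' (s0Of_un.comp hD) (const _ (1 : ℕ)))) hT) (umul' (const _ (2 : ℕ)) MOf_un))
    (const _ (2 : ℕ))).congr fun _ => rfl

/-- `p` in unary from `(D, 1ᵀ)`. [folklore] -/
theorem precOf_un : CodeFP (pairE natE unE) unE (fun p => precOf p.1 p.2) := by
  have hD : CodeFP (pairE natE unE) natE (fun p => p.1) := fst _ _
  have hT : CodeFP (pairE natE unE) unE (fun p => p.2) := snd _ _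
  exact (uadd' (uadd' (uadd' hT (codeFP_unSize.comp (natOfUn.comp XOf_un)))
    (codeFP_unSize.comp (natOfUn.comp (uadd' (umul' (const _ (4 : ℕ)) (codeFP_unSize.comp hD)) (const _ (29 : ℕ)))))) (const _ (10 : ℕ))).congr
    fun _ => rfl

/-! ### The package -/

/-- **The grid** `N = 2^{2|x|+28}` of the input `x`. [cite: Jozsa2003, §9] -/
@[irreducible] def gridN (x : List Bool) : ℕ := 2 ^ (2 * x.length + 28)

/-- The grid, unfolded (kept irreducible so that tactics never normalise the power). [folklore] -/
theorem gridN_eq (x : List Bool) : gridN x = 2 ^ (2 * x.length + 28) := by rw [gridN]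

variable (q : Polynomial ℕ)

/-- **The doubling depth of the input** for the family of block-length polynomial `q`:
`T = (3 size D + 4) + n + q(n)`, `n = |⟨x, ε⟩|` — so that the walk reaches every `2^{L_u}/N`. [cite: Jozsa2003, §9] -/
def Tx (x : List Bool) : ℕ := TOf (Dof (decodeNat x)) + coreLen x + q.eval (coreLen x)

/-- **The walk parameters of Hallgren's post-processor**: instance `(D, p)` with `D = fundDiscr(decodeNat x)`,
depth `T = Tx q x`, precision `p = precOf D T + 2|x| + 30`, grid `N = 2^{2|x|+28}`, `δ₀ = 8`, the budgets
of `HallgrenParams.lean`, `Lmin(n) = 6n + 100`. [cite: Jozsa2003, §9] -/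
def hallgrenW : WalkParams (ℕ × ℕ) where
  dOf x := (Dof (decodeNat x), precOf (Dof (decodeNat x)) (Tx q x) + (2 * x.length + 30))
  N x := gridN x
  δ₀ := 8
  s₀ x := s0Of (Dof (decodeNat x))
  T x := Tx q x
  M x := MOf (Dof (decodeNat x)) (Tx q x)
  Lmin n := 6 * n + 100

/-- The discriminant of the input as a program. [folklore] -/
theorem codeFP_DofInput : CodeFP strE natE (fun x => Dof (decodeNat x)) := codeFP_Dof.comp codeFP_decodeNat

/-- The depth in unary. [folklore] -/
theorem Tx_un : CodeFP strE unE (Tx q) :=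
  (uadd' (uadd' (TOf_un.comp codeFP_DofInput) coreLen_un) ((QuantumComplexity.YaoSim.codeFP_T_un q).comp coreLen_un)).congr fun _ => rfl

/-- The extra precision `2|x| + 30` in unary. [folklore] -/
theorem extraPrec_un : CodeFP strE unE (fun x : List Bool => 2 * x.length + 30) :=
  uadd' (umul' (const strE (2 : ℕ)) strLength) (const strE (30 : ℕ))

/-- The instance program. [folklore] -/
theorem hallgrenW_dOf_fp : CodeFP strE dE (hallgrenW q).dOf :=
  (codeFP_DofInput.pair (uadd' (precOf_un.comp (codeFP_DofInput.pair (Tx_un q))) extraPrec_un)).congr fun _ => rfl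

/-- The grid program `N = 2^{2|x|+28}`. [folklore] -/
theorem hallgrenW_N_fp : CodeFP strE natE (hallgrenW q).N :=
  (natPow.comp ((const strE (2 : ℕ)).pair (uadd' (umul' (const strE (2 : ℕ)) strLength) (const strE (28 : ℕ))))).congr fun x => by
    show 2 ^ (2 * x.length + 28) = gridN x; rw [gridN_eq]

/-- `s₀` program. [folklore] -/
theorem hallgrenW_s₀_fp : CodeFP strE unE (hallgrenW q).s₀ := (s0Of_un.comp codeFP_DofInput).congr fun _ => rfl

/-- `T` program. [folklore] -/
theorem hallgrenW_T_fp : CodeFP strE unE (hallgrenW q).T := (Tx_un q).congr fun _ => rfl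

/-- `M` program. [folklore] -/
theorem hallgrenW_M_fp : CodeFP strE unE (hallgrenW q).M := (MOf_un.comp (codeFP_DofInput.pair (Tx_un q))).congr fun _ => rfl

/-- `Lmin` program. [folklore] -/
theorem hallgrenW_Lmin_fp : CodeFP unE unE (hallgrenW q).Lmin :=
  (uadd' (umul' (const unE (6 : ℕ)) (CodeFP.id unE)) (const unE (100 : ℕ))).congr fun _ => rfl

/-- **Hallgren's post-processor is a polynomial-time string function** (the instance of
`HallgrenPost.exists_postFn`). [cite: Jozsa2003, §10] [cite: AroraBarak2009, §1.3] -/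
theorem exists_postFn_hallgren :
    ∃ g : List Bool → List Bool, g ∈ FP ∧ ∀ x y, g (boolPair x y) = postPair q hallgrenOps (hallgrenW q) x y :=
  exists_postFn q hallgrenOps (hallgrenW q) hallgrenSpec (pairE_injective intE_injective intE_injective) (hallgrenW_dOf_fp q)
    (hallgrenW_N_fp q) (hallgrenW_s₀_fp q) (hallgrenW_T_fp q) (hallgrenW_M_fp q) (hallgrenW_Lmin_fp q)

end HallgrenGiantStep

end Literature.Computability.Cryptography

end
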